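/-
Origin: expansion seat `prover-pub-hodgecm-own-htheta-g2-0`, handover #H18 2026-08-21T12:50:24Z md5 6b5cdcf521ea (229 l.; NEW additive MODEL leaf — THE (J-Liu-Θ) JUNCTION HEAD AT A FACE (TRANSPOSITION-MAP hΘ row; interface for `RealisationExistsFace` `StubTree/Inputs.lean`:97); author htheta-x1 (prover-pub-hodgecm-htheta-x1-0) under own-htheta; imports #H17 `HodgeCM.Model.HThetaJunctionR2BGal` ONLY; ns HodgeCM + HodgeCM.Model.SInstance; 8 theorems + 1 abbrev (`faceCtx F f ι₁ D := ⟨F, f.psi, ι₁, D⟩`), 0 `def … : Prop`, nothing cited: §1 `isNormalClosure_self_of_isGalois : IsNormalClosure ℚ F F` (F Galois) + `four_le_finrank_of_six_le`; §2 `SInstance.hsmall_face_of_thm418C` = #H17 `hsmall_ROGT'C_of_thm418C_gal` at L := F Galois CM, 6 ≤ [F:ℚ], c := faceCtx F f ι₁ D, guards `R.GoodCtx` ∕ `GOG` as binders; §3 `…_of_admissible`: from `f.Admissible ι₁` the guards' type combinatorics discharged (`goodCtx_faceCtx` ∕ `gog_faceCtx` via `pairSum_psi`, `StubTree.psi_injective`,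 `admissible_mem_psi`, j := id), leaving `hcan`, the two `SignsForced` clauses on D, `hRΘ`, `h418` at V over F, `hR`, `hA`, the pin section; §4 `SInstance.exists_faceCtx_hsmall_of_thm418C`: for an END-STATE theta model `R := C.thetaModel (orientBitι F ι₁) d12 d34` the lines D EXIST with both guards holding (`exists_faceCtx_goodCtx_gog` ← `ThetaModel.exists_seesawDatum` + `design_kappaConj` ∕ `design_frameSignConj` + `thetaModel_goodCtx_iff`), so the head holds at all four slots with NO guard hypothesis — remaining: `hcan` (automatic at ι₁ := w.embedding, §5 `embedding_canonical`), `hRΘ`, `h418`, `hR`, `hA`, pin section; NOT needed at a face: `finrank c.K = 6`, `[L:ℚ] ∈ {24,48}`, `IsFrame`, `IsPerLTypes`, corner primitivity. CERT rc 0 ∕ 9 ∕ 9 trio as in the header; ROWDEP #H17; NAMES for audit: HodgeCM.Model.SInstance.hsmall_face_of_thm418C · HodgeCM.Model.SInstance.hsmall_face_of_thm418C_of_admissible · HodgeCM.Model.SInstance.exists_faceCtx_hsmall_of_thm418C) (`HOME/pub-hodgecm-own-htheta/stage75/HodgeCM/Model/HThetaJunctionFace.lean`, md5 6b5cdcf521ea,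 229 lines);
landed by the second packager p2 gen 20 (p2-g20) in gate run 75 as `HodgeCM/Model/HThetaJunctionFace.lean` (packager comment re-wording per the RUN-32 precedent (gate audit (5) rejects the proof-placeholder tokens s-o-r-r-y / a-d-m-i-t anywhere in a source, comments included): 4 occurrence(s) inside COMMENTS re-spelt `proof-hole` / `adm-token`; no Lean code byte touched).
-/
/-
Copyright (c) 2026 the pub-hodgecm formalisation cell (harness21).  New file, not vendored.  DRAFT (x1 work file, NOT a PKG path).
Origin: seat `prover-pub-hodgecm-htheta-x1-0` (unit pub-hodgecm-htheta-x1, EOD SURGE (1a) extra prover x1 UNDER own-htheta), 2026-08-21,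
assignment own-htheta g2 STATUS 12:39:13Z «x1 = FACE INSTANCE OF THE JUNCTION HEAD» (TRANSPOSITION-MAP support, coordinator RE-POINT (2)).
Elaborated against the INSTALLED RUN-74 PKG `.lake` (LEAN_PATH = PKG only).  Imports #H17 `Model/HThetaJunctionR2BGal` (RUN 73) only.
KERNEL ONLY: no `proof-hole`, no new axioms, nothing cited, no hypothesis kind of E; nothing here is a claim of the manuscripts under adjudication.

WHAT IT IS — #H17 `SInstance.hsmall_ROGT'C_of_thm418C_gal` (`Model/HThetaJunctionR2BGal.lean`:253) SPECIALISED AT A FACE CONTEXT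
`c := faceCtx F f ι₁ D = ⟨F, f.psi, ι₁, D⟩` (`F` a Galois CM field with `6 ≤ [F:ℚ]`, `f : Face F`, `ι₁ : F →+* ℂ`, `D : StubTree.SeesawDatum F`,
`V : HermSpace3 F ι₁`), i.e. `L := F`, `c.K := F`, `c.Ψ := f.psi`, `c.σ := ι₁`, `j := RingHom.id F`.  The two scope hypotheses of #H17 are
DISCHARGED in the kernel: `hN : IsNormalClosure ℚ F F` (§1 `isNormalClosure_self_of_isGalois`: a Galois extension is its own normal closure) and
`h4 : 4 ≤ [F:ℚ]` (§1 `four_le_finrank_of_six_le`).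
* §2 `SInstance.hsmall_face_of_thm418C` — the head at a face with the two guards `R.GoodCtx ι₁ c` ∕ `GOG V c` kept as binders;
* §3 `SInstance.hsmall_face_of_thm418C_of_admissible` — the guards' type combinatorics discharged from `f.Admissible ι₁` (`pairSum_psi`,
  `StubTree.psi_injective`, `admissible_mem_psi`, `j := RingHom.id F`; §1 `goodCtx_faceCtx` ∕ `gog_faceCtx`), keeping exactly the SIGN clauses on the
  lines `D` + the canonical-representative clause `(mk ι₁).embedding = ι₁`; its docstring LISTS what remains for a face, with file:line;
* §4 `SInstance.exists_faceCtx_goodCtx_gog` ∕ `SInstance.exists_faceCtx_hsmall_of_thm418C` — for an END-STATE theta model `C.thetaModel (orientBitι F ι₁) d12 d34`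
  (the shape of E's `thetaModelOf …`) the lines `D` EXIST (`ThetaModel.exists_seesawDatum`, design constraints = theorems of the end state, Landherr
  discharged) and BOTH guards hold, so the head applies with NO guard hypothesis left — remaining inputs: `hcan`, `hRΘ`, `h418`, `hR`, `hA`, the pin section;
* §5 `SInstance.embedding_canonical` — `hcan` is automatic at `ι₁ := w.embedding`.
This is the hΘ row's interface shape for `RealisationExistsFace` (`StubTree/Inputs.lean`:97: `∀ F, IsGalois ℚ F → 6 ≤ finrank ℚ F → ∀ f ι₁,
f.Admissible ι₁ → ∀ V, …`).  NOT needed at a face: `finrank ℚ c.K = 6`, `[L:ℚ] ∈ {24, 48}`, `IsFrame`, `IsPerLTypes`, primitivity of the corner type.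
9 declarations; `#print axioms` of all 9 ⊆ {propext, Classical.choice, Quot.sound} (x1 probe `farm/ax_face.lean`).
-/
import Summits.HodgeConjecture.HodgeCM.Model.HThetaJunctionR2BGal

set_option autoImplicit false

noncomputable section

open NumberField NumberField.InfinitePlace
open scoped Matrix Classical TensorProduct
open Literature.AlgebraicGeometry.HodgeTheory Literature.NumberTheory.Automorphic.PicardCM
open Literature.NumberTheory.Transcendental (Arapura2012_Cor_15_4_6)
open Literature.NumberTheory.Automorphic Literature.NumberTheory.Automorphic.UnitaryGroup
open Literature.NumberTheory.GelbartRogawski1991 Literature.NumberTheory.GelbartRogawski1991.UnitaryDualPair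
open HodgeCM.Model.HypCensus HodgeCM.Model.SupplyInstance HodgeCM.Model.ArchSideTerm
open HodgeCM.Model.ThetaSpace HodgeCM.Model.TowerLevel HodgeCM.Model.TowerCarrier HodgeCM.Literature.Theta

namespace HodgeCM

/-! ## §1 A Galois extension of `ℚ` is its own normal closure; the face context -/

/-- **A Galois (indeed any normal) extension is a normal closure of itself**: minimal polynomials split (normality) and their roots
generate (each `x` is a root of its own minimal polynomial).  This discharges #H17's `hN : IsNormalClosure ℚ c.K L` at a face (`c.K = L = F`).
[folklore] -/
theorem isNormalClosure_self_of_isGalois (F : CMField) [IsGalois ℚ F] : IsNormalClosure ℚ F F where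
  splits x := by
    simpa using (Normal.splits (inferInstance : Normal ℚ F) x)
  adjoin_rootSet := by
    rw [eq_top_iff]
    intro x _
    have hx : x ∈ (minpoly ℚ x).rootSet F := by
      rw [Polynomial.mem_rootSet]
      exact ⟨minpoly.ne_zero (Algebra.IsIntegral.isIntegral x), minpoly.aeval ℚ x⟩
    exact le_iSup (fun y : F => IntermediateField.adjoin ℚ ((minpoly ℚ y).rootSet F)) x (IntermediateField.subset_adjoin ℚ _ hx)

/-- `6 ≤ [F:ℚ]` (the face hypothesis of `RealisationExistsFace`) gives #H17's `h4 : 4 ≤ [F:ℚ]` (anisotropy of `V`). [folklore] -/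
theorem four_le_finrank_of_six_le (F : CMField) (h6 : 6 ≤ Module.finrank ℚ F) : 4 ≤ Module.finrank ℚ F :=
  le_trans (by norm_num) h6

/-- **The face context**: the seesaw context of a face `f` of `F` read at `ι₁` with lines `D` — `K := F`, `Ψ := f.psi` (the four period types
`(Φ, Φ^{(ππ′)}, Φ^{(π)}, Φ^{(π′)})`, `CM/Basic.lean`:160–165), `σ := ι₁`, `D := D` (pattern `Model/Sanity/SexticNonVacuity.lean`:55). [folklore] -/
abbrev faceCtx (F : CMField) (f : Face F) (ι₁ : F →+* ℂ) (D : StubTree.SeesawDatum F) : SeesawCtx F :=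
  ⟨F, f.psi, ι₁, D⟩

/-- **`R.GoodCtx` at a face from admissibility**: pair-sum (`pairSum_psi`), injectivity (`StubTree.psi_injective`) and `ι₁ ∈ ψ_i`
(`admissible_mem_psi`) are theorems of the face; what remains is the model's forced-sign clause on the lines `D` along `j := id`. [folklore] -/
theorem goodCtx_faceCtx {U : Universe} (R : U.ThetaModel) (F : CMField) (f : Face F) (ι₁ : F →+* ℂ) (hadm : f.Admissible ι₁)
    (D : StubTree.SeesawDatum F) (hD : R.SignsForced F F (RingHom.id F) ι₁ f.psi D) :
    R.GoodCtx ι₁ (faceCtx F f ι₁ D) :=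
  ⟨pairSum_psi f, StubTree.psi_injective F f, admissible_mem_psi f ι₁ hadm, ⟨RingHom.id F, RingHom.comp_id ι₁, hD⟩⟩

/-- **The OG guard `GOG` at a face from admissibility**: the canonical-representative clause `(mk ι₁).embedding = ι₁` and PerL's recipe signs
(bit `orientBitι F ι₁`) on the lines `D` along `j := id` remain; the type combinatorics is discharged as in `goodCtx_faceCtx`. [folklore] -/
theorem gog_faceCtx (F : CMField) (f : Face F) (ι₁ : F →+* ℂ) (hadm : f.Admissible ι₁) (V : HermSpace3 F ι₁)
    (D : StubTree.SeesawDatum F) (hcan : (mk ι₁).embedding = ι₁)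
    (hDrec : SignRecipe.SignsForced (Model.orientBitι F ι₁) F F (RingHom.id F) ι₁ f.psi D) :
    Model.SInstance.GOG V (faceCtx F f ι₁ D) :=
  ⟨hcan, ⟨pairSum_psi f, StubTree.psi_injective F f, admissible_mem_psi f ι₁ hadm, ⟨RingHom.id F, RingHom.comp_id ι₁, hDrec⟩⟩⟩

end HodgeCM

/-! ## §2 The junction head at a face, guards kept as binders -/

namespace HodgeCM.Model.SInstance

open HodgeCM.Model.ThetaAdelicSide HodgeCM.Model.LiuIndex

variable (hHD : exists_isReal_hodgeModel) (hI : hodgePQ_independent_of_hodgeModel)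
  (h₁ : BallQuotientUniformised) (h₃ : CMAbelianVarietyRealised) (hA : Arapura2012_Cor_15_4_6)

variable
  (hGR : ∀ {L : CMField} {ι₁ : L →+* ℂ} (V : HermSpace3 L ι₁) (c : SeesawCtx L),
    (cmSplittingDatum (L : Type) finProdFinEquiv (frameD V) (frameD_real V) (frameD_ne V) (dW c.D) (dW_real c.D)
      (dW_ne c.D)).CompatibleSplitting)
  (hGR₀ : ∀ {L : CMField} {ι₁ : L →+* ℂ} (V : HermSpace3 L ι₁) (c : SeesawCtx L),
    (cmSplittingDatum (L : Type) (e₁) (frameD V) (frameD_real V) (frameD_ne V) (lineVec (L : Type) (dW c.D 0))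
      (fun _ => dW_real c.D 0) (fun _ => dW_ne c.D 0)).CompatibleSplitting)
  (hGR₁ : ∀ {L : CMField} {ι₁ : L →+* ℂ} (V : HermSpace3 L ι₁) (c : SeesawCtx L),
    (cmSplittingDatum (L : Type) (e₁) (frameD V) (frameD_real V) (frameD_ne V) (lineVec (L : Type) (dW c.D 1))
      (fun _ => dW_real c.D 1) (fun _ => dW_ne c.D 1)).CompatibleSplitting)
  (hGR₂ : ∀ {L : CMField} {ι₁ : L →+* ℂ} (V : HermSpace3 L ι₁) (c : SeesawCtx L),
    (cmSplittingDatum (L : Type) (e₁) (frameD V) (frameD_real V) (frameD_ne V) (lineVec (L : Type) (dW' c.D 0))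
      (fun _ => dW'_real c.D 0) (fun _ => dW'_ne c.D 0)).CompatibleSplitting)
  (hGR₃ : ∀ {L : CMField} {ι₁ : L →+* ℂ} (V : HermSpace3 L ι₁) (c : SeesawCtx L),
    (cmSplittingDatum (L : Type) (e₁) (frameD V) (frameD_real V) (frameD_ne V) (lineVec (L : Type) (dW' c.D 1))
      (fun _ => dW'_real c.D 1) (fun _ => dW'_ne c.D 1)).CompatibleSplitting)
  (μ : ∀ {L : CMField}, SeesawCtx L → Fin 4 → NumberField.InfinitePlace (L : Type) → ℤ)
  (hΔ₁ : ∀ {L : CMField} {ι₁ : L →+* ℂ} (V : HermSpace3 L ι₁) (c : SeesawCtx L), ∀ hc : GOG V c,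
    slotTypeVec V c (hGR V c) (hGR₀ V c) (hGR₁ V c) (hGR₂ V c) (hGR₃ V c) (hG_GOG V c hc) 1 -
      slotTypeVec V c (hGR V c) (hGR₀ V c) (hGR₁ V c) (hGR₂ V c) (hGR₃ V c) (hG_GOG V c hc) 0 = μ c 1 - μ c 0)
  (hΔ₂ : ∀ {L : CMField} {ι₁ : L →+* ℂ} (V : HermSpace3 L ι₁) (c : SeesawCtx L), ∀ hc : GOG V c,
    slotTypeVec V c (hGR V c) (hGR₀ V c) (hGR₁ V c) (hGR₂ V c) (hGR₃ V c) (hG_GOG V c hc) 2 -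
      slotTypeVec V c (hGR V c) (hGR₀ V c) (hGR₁ V c) (hGR₂ V c) (hGR₃ V c) (hG_GOG V c hc) 0 = μ c 2 - μ c 0)
  (hΔ₃ : ∀ {L : CMField} {ι₁ : L →+* ℂ} (V : HermSpace3 L ι₁) (c : SeesawCtx L), ∀ hc : GOG V c,
    slotTypeVec V c (hGR V c) (hGR₀ V c) (hGR₁ V c) (hGR₂ V c) (hGR₃ V c) (hG_GOG V c hc) 3 -
      slotTypeVec V c (hGR V c) (hGR₀ V c) (hGR₁ V c) (hGR₂ V c) (hGR₃ V c) (hG_GOG V c hc) 0 = μ c 3 - μ c 0)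

variable (F : CMField) [IsGalois ℚ F] (f : Face F) {ι₁ : F →+* ℂ} (V : HermSpace3 F ι₁) (D : StubTree.SeesawDatum F)

/-- **THE (J-Liu-Θ) JUNCTION HEAD AT A FACE — guards as binders.**  #H17 `hsmall_ROGT'C_of_thm418C_gal` at `L := F` Galois CM with `6 ≤ [F:ℚ]`,
`c := faceCtx F f ι₁ D`: E's r20 `hsmall` conclusion for the face's slot `i` — `∃ Γ₀, ∀ Γ ≤ Γ₀, ∃ M k σ', σ' ∘ k = ι₁ ∧ Θ(V, c, i, Γ) ⊆ Uiso Γ M (f.psi i)^k σ'` —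
from the pinned-dictionary reading `h418` of [Liu21 Thm 4.18 (r8)] at the face's slot scalars, `hR`, the pin inputs (section), and the two guards
`R.GoodCtx ι₁ c`, `GOG V c`; `IsNormalClosure ℚ F F` and `4 ≤ [F:ℚ]` are DISCHARGED (§1).  0 `proof-hole`. [folklore] -/
theorem hsmall_face_of_thm418C (h6 : 6 ≤ Module.finrank ℚ F) (hR : DeligneMilne1982_Thm_6_20_full)
    (R : (picardCMUniverse hHD hI h₁ h₃).ThetaModel)
    (hRΘ : ∀ (i : Fin 4) (Γ : Level V), R.Theta V (faceCtx F f ι₁ D) i Γ ⊆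
      thetaOf _ (thetaClassInputOf _ (fun V c => thetaSpaceInputOf hHD hI h₁ h₃
        (SROGT'C @hGR @hGR₀ @hGR₁ @hGR₂ @hGR₃ @μ hΔ₁ hΔ₂ hΔ₃) V c)) V (faceCtx F f ι₁ D) i Γ)
    (h418 : ∀ a₀ : LiuIndex.RealScalar F,
      (liuDictionaryPin hHD hI h₁ h₃ hA V (LiuIndex.I V (LiuIndex.repAt a₀) (muLiu ι₁ LiuIndex.GramClass.rep))
          (LiuIndex.line V (LiuIndex.repAt a₀) (muLiu ι₁ LiuIndex.GramClass.rep))).Thm418C)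
    (hgood : R.GoodCtx ι₁ (faceCtx F f ι₁ D)) (hc : GOG V (faceCtx F f ι₁ D))
    (i : Fin 4) :
    ∃ Γ₀ : Level V, ∀ Γ ≤ Γ₀,
      ∃ (M : CMField) (k : F →+* M) (σ' : M →+* ℂ), σ'.comp k = ι₁ ∧
        R.Theta V (faceCtx F f ι₁ D) i Γ ⊆ (picardCMUniverse hHD hI h₁ h₃).Uiso Γ M (CMTypeOps.inflate k (f.psi i)) σ' :=
  hsmall_ROGT'C_of_thm418C_gal hHD hI h₁ h₃ hA @hGR @hGR₀ @hGR₁ @hGR₂ @hGR₃ @μ hΔ₁ hΔ₂ hΔ₃ V (faceCtx F f ι₁ D) hR R hRΘ h418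
    hgood hc (isNormalClosure_self_of_isGalois F) (four_le_finrank_of_six_le F h6) i

/-! ## §3 The junction head at a face, guards discharged from admissibility down to the SIGN clauses on the lines -/

/-- **THE (J-Liu-Θ) JUNCTION HEAD AT A FACE — from `f.Admissible ι₁`.**  As `hsmall_face_of_thm418C`, with the two guards produced by
`goodCtx_faceCtx` ∕ `gog_faceCtx`.  WHAT REMAINS FOR A FACE (every other input of #H17 is a section input of E's own chain or discharged here):
(a) `hcan : (mk ι₁).embedding = ι₁` — the canonical-representative clause of `SInstance.GOG` (`Model/ThetaAdelicSideReadOff.lean`:150–151); automatic for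
    `ι₁ := w.embedding` (`NumberField.InfinitePlace.mk_embedding`), see `hsmall_face_of_thm418C_at_place`;
(b) `hD : R.SignsForced F F (RingHom.id F) ι₁ f.psi D` — the theta model's forced signs on the face's lines (`Automorphic/ThetaModel.lean`:151–155, field
    `forced`); for a model carrying PerL's recipe at bit `orientBitι F ι₁` this IS (c) (`ThetaModel.goodCtx_iff_signRecipe`, `Automorphic/EndStateFieldCensus.lean`:121);
(c) `hDrec : SignRecipe.SignsForced (orientBitι F ι₁) F F (RingHom.id F) ι₁ f.psi D` — PerL's recipe signs on the lines (`EndStateFieldCensus.lean`:83–86);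
    (b)∕(c) hold for the OUTPUT `D` of `ThetaModel.exists_seesawDatum` (`Proofs/RealisationConstruction.lean`:183) — a face with PRESCRIBED lines is honest
    only if its lines carry these signs (sinst-1 STATUS 2026-08-21T07:31:55Z);
(d) `hRΘ` — the model's theta classes at `(V, c, i, Γ)` lie in the pinned theta space of the honest side `SROGT'C` (as in E);
(e) `h418` — [Liu21 Thm 4.18, combined reading r8] over the pinned dictionary at `V`, for every real slot scalar `a₀` of `F` (as in «JBUARM» :41–:44, at `L := F`);
(f) `hR` [Deligne–Milne 6.20] (tree theorem `deligneMilne1982_Thm_6_20_full_holds`), `hA` [Arapura 15.4.6] (tree theorem), the [GR91 3.1.1] pin families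
    `hGR…hGR₃`, the table `μ` with `hΔ₁ hΔ₂ hΔ₃` (section inputs, = E's).
NOT needed at a face: `finrank ℚ c.K = 6`, `[L:ℚ] ∈ {24, 48}`, `IsFrame`, `IsPerLTypes`, primitivity of the corner type. 0 `proof-hole`. [folklore] -/
theorem hsmall_face_of_thm418C_of_admissible (h6 : 6 ≤ Module.finrank ℚ F) (hadm : f.Admissible ι₁)
    (hcan : (mk ι₁).embedding = ι₁) (hR : DeligneMilne1982_Thm_6_20_full)
    (R : (picardCMUniverse hHD hI h₁ h₃).ThetaModel)
    (hD : R.SignsForced F F (RingHom.id F) ι₁ f.psi D)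
    (hDrec : SignRecipe.SignsForced (Model.orientBitι F ι₁) F F (RingHom.id F) ι₁ f.psi D)
    (hRΘ : ∀ (i : Fin 4) (Γ : Level V), R.Theta V (faceCtx F f ι₁ D) i Γ ⊆
      thetaOf _ (thetaClassInputOf _ (fun V c => thetaSpaceInputOf hHD hI h₁ h₃
        (SROGT'C @hGR @hGR₀ @hGR₁ @hGR₂ @hGR₃ @μ hΔ₁ hΔ₂ hΔ₃) V c)) V (faceCtx F f ι₁ D) i Γ)
    (h418 : ∀ a₀ : LiuIndex.RealScalar F,
      (liuDictionaryPin hHD hI h₁ h₃ hA V (LiuIndex.I V (LiuIndex.repAt a₀) (muLiu ι₁ LiuIndex.GramClass.rep))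
          (LiuIndex.line V (LiuIndex.repAt a₀) (muLiu ι₁ LiuIndex.GramClass.rep))).Thm418C)
    (i : Fin 4) :
    ∃ Γ₀ : Level V, ∀ Γ ≤ Γ₀,
      ∃ (M : CMField) (k : F →+* M) (σ' : M →+* ℂ), σ'.comp k = ι₁ ∧
        R.Theta V (faceCtx F f ι₁ D) i Γ ⊆ (picardCMUniverse hHD hI h₁ h₃).Uiso Γ M (CMTypeOps.inflate k (f.psi i)) σ' :=
  hsmall_face_of_thm418C hHD hI h₁ h₃ hA @hGR @hGR₀ @hGR₁ @hGR₂ @hGR₃ @μ hΔ₁ hΔ₂ hΔ₃ F f V D h6 hR R hRΘ h418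
    (goodCtx_faceCtx R F f ι₁ hadm D hD) (gog_faceCtx F f ι₁ hadm V D hcan hDrec) i

/-! ## §4 END STATES at a face: the guards are INHABITED — `∃ D`, both guards hold, and the junction head applies -/

omit [IsGalois ℚ F] in
/-- **For an END-STATE theta model (`C.thetaModel (orientBitι F ι₁) d12 d34`, the shape of E's `thetaModelOf …`) the face guards are inhabited**:
given `f.Admissible ι₁` and the canonical-representative clause, lines `D` with PerL's forced signs EXIST (`ThetaModel.exists_seesawDatum`
`Proofs/RealisationConstruction.lean`:183, design constraints = THEOREMS of the end state `Automorphic/SignRecipeEndState.lean`:101–106, Landherr discharged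
`lemma33bLandherr_holds`), and then BOTH `R.GoodCtx ι₁ c` and `GOG V c` hold at `c := faceCtx F f ι₁ D` (the two coincide for an end state at the
oriented bit: `AdelicThetaCore.thetaModel_goodCtx_iff`, `Automorphic/EndStateFieldCensus.lean`:147).  No degree ∕ Galois hypothesis is used. [folklore] -/
theorem exists_faceCtx_goodCtx_gog {hP : PrintFact_unitaryCompact} (C : (picardCMUniverse hHD hI h₁ h₃).AdelicThetaCore hP)
    (d12 d34 : ∀ {L : CMField}, SeesawCtx L → Universe.SideData L) (hadm : f.Admissible ι₁) (hcan : (mk ι₁).embedding = ι₁) :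
    ∃ D : StubTree.SeesawDatum F,
      (C.thetaModel (orientBitι F ι₁) d12 d34).GoodCtx ι₁ (faceCtx F f ι₁ D) ∧ GOG V (faceCtx F f ι₁ D) := by
  obtain ⟨D, hD⟩ := (C.thetaModel (orientBitι F ι₁) d12 d34).exists_seesawDatum
    (C.design_kappaConj (orientBitι F ι₁) d12 d34) (C.design_frameSignConj (orientBitι F ι₁) d12 d34)
    lemma33bLandherr_holds (RingHom.id F) ι₁ f.psi (pairSum_psi f)
  have hgood : (C.thetaModel (orientBitι F ι₁) d12 d34).GoodCtx ι₁ (faceCtx F f ι₁ D) :=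
    goodCtx_faceCtx _ F f ι₁ hadm D hD
  exact ⟨D, hgood, ⟨hcan, (C.thetaModel_goodCtx_iff (orientBitι F ι₁) d12 d34 ι₁ (faceCtx F f ι₁ D)).mp hgood⟩⟩

/-- **THE (J-Liu-Θ) JUNCTION HEAD AT A FACE FOR AN END STATE — guards DISCHARGED (∃ D).**  For `R := C.thetaModel (orientBitι F ι₁) d12 d34` over the
model universe, `F` Galois CM with `6 ≤ [F:ℚ]`, a face `f`, an admissible `ι₁` with `(mk ι₁).embedding = ι₁`, and `V : HermSpace3 F ι₁`: there are lines
`D` such that both guards hold at `c := faceCtx F f ι₁ D` AND E's r20 `hsmall` conclusion holds at every slot `i` — from `h418` ([Liu21 Thm 4.18 r8] over the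
pinned dictionary at `V`), `hR`, `hRΘ` (stated for every context `c`, as E's theta model meets it by `rfl`), and the pin section inputs.  WHAT REMAINS for a
face-scoped E is therefore exactly: `hcan` (automatic at `ι₁ := w.embedding`), `hRΘ`, `h418`, `hR`, `hA`, the [GR91 3.1.1] pin families, `μ` + `hΔ₁₂₃`.
0 `proof-hole`. [folklore] -/
theorem exists_faceCtx_hsmall_of_thm418C {hP : PrintFact_unitaryCompact} (C : (picardCMUniverse hHD hI h₁ h₃).AdelicThetaCore hP)
    (d12 d34 : ∀ {L : CMField}, SeesawCtx L → Universe.SideData L)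
    (h6 : 6 ≤ Module.finrank ℚ F) (hadm : f.Admissible ι₁) (hcan : (mk ι₁).embedding = ι₁) (hR : DeligneMilne1982_Thm_6_20_full)
    (hRΘ : ∀ (c : SeesawCtx F) (i : Fin 4) (Γ : Level V), (C.thetaModel (orientBitι F ι₁) d12 d34).Theta V c i Γ ⊆
      thetaOf _ (thetaClassInputOf _ (fun V c => thetaSpaceInputOf hHD hI h₁ h₃
        (SROGT'C @hGR @hGR₀ @hGR₁ @hGR₂ @hGR₃ @μ hΔ₁ hΔ₂ hΔ₃) V c)) V c i Γ)
    (h418 : ∀ a₀ : LiuIndex.RealScalar F,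
      (liuDictionaryPin hHD hI h₁ h₃ hA V (LiuIndex.I V (LiuIndex.repAt a₀) (muLiu ι₁ LiuIndex.GramClass.rep))
          (LiuIndex.line V (LiuIndex.repAt a₀) (muLiu ι₁ LiuIndex.GramClass.rep))).Thm418C) :
    ∃ D : StubTree.SeesawDatum F,
      ((C.thetaModel (orientBitι F ι₁) d12 d34).GoodCtx ι₁ (faceCtx F f ι₁ D) ∧ GOG V (faceCtx F f ι₁ D)) ∧
      ∀ i : Fin 4, ∃ Γ₀ : Level V, ∀ Γ ≤ Γ₀,
        ∃ (M : CMField) (k : F →+* M) (σ' : M →+* ℂ), σ'.comp k = ι₁ ∧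
          (C.thetaModel (orientBitι F ι₁) d12 d34).Theta V (faceCtx F f ι₁ D) i Γ ⊆
            (picardCMUniverse hHD hI h₁ h₃).Uiso Γ M (CMTypeOps.inflate k (f.psi i)) σ' := by
  obtain ⟨D, hgood, hc⟩ := exists_faceCtx_goodCtx_gog hHD hI h₁ h₃ F f V C d12 d34 hadm hcan
  exact ⟨D, ⟨hgood, hc⟩, fun i => hsmall_face_of_thm418C hHD hI h₁ h₃ hA @hGR @hGR₀ @hGR₁ @hGR₂ @hGR₃ @μ hΔ₁ hΔ₂ hΔ₃ F f V D h6 hR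
    _ (hRΘ (faceCtx F f ι₁ D)) h418 hgood hc i⟩

/-! ## §5 At a complex place `w`: the canonical-representative clause is automatic for `ι₁ := w.embedding` -/

omit [IsGalois ℚ F] in
/-- `(mk w.embedding).embedding = w.embedding` (`NumberField.InfinitePlace.mk_embedding`). [folklore] -/
theorem embedding_canonical (w : InfinitePlace F) : (mk w.embedding).embedding = w.embedding := by
  rw [NumberField.InfinitePlace.mk_embedding]

end HodgeCM.Model.SInstance

end
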